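import Mathlib.Analysis.SpecialFunctions.ExpDeriv
import Summits.HubbardSuperconductivity.HubbardSuperconductivity.Theorems.BirComplexStableXY.Negative.WitnessTable
import HarnessLib

/-!
# Crux `BirComplexStableXYR` (stmt-HubbardSuperconductivity-14845), line `fat-gaussian-defect-calculus`:
# stub `stub_genF_contDiff` — the window weight `F` is a smooth function of the window field

Helper (`--supports`) for the crux
`Summit.HubbardSuperconductivity.HubbardSuperconductivity.Theses.BalabanIR.BirComplexStableXYR`, line
`fat-gaussian-defect-calculus` (lead skeleton `Cruxes/BirComplexStableXYR/Lines/fat_gaussian_defect_calculus.lean`),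
registered stub `stub_genF_contDiff`.

**Statement.** For every window size `r`, every finite Fourier table `c : Table r` (vocabulary `Table`,
`W`, `genF` of `Theorems.BirComplexStableXY.Negative.WitnessTable`) and every natural `N`, the local
generating function `φ ↦ F(φ) = Σ_n c_n exp(i n·φ)` is `C^N` as a function of `φ : W r → ℝ`
(this feeds the `T_φ`-seminorm calculus, which needs `ContDiff ℝ N` for every natural `N`).

**Proof.** `genF c φ` is the finite sum `∑ n ∈ c.support, c n * exp(i · ↑(∑ w, n w * φ w))`
(`Finsupp.sum`).  Each coordinate `φ ↦ φ w` is a continuous linear map (`contDiff_apply`), so the real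
phase `∑ w, n w * φ w` is smooth (`ContDiff.sum`, `ContDiff.mul`), its cast to `ℂ` is the continuous linear
map `Complex.ofRealCLM`, and `Complex.exp` is smooth (`Complex.contDiff_exp`); finite sums and products of
`C^N` maps are `C^N`.  In fact we prove `ContDiff ℝ n` for every `n : WithTop ℕ∞` and specialise.
No definitions; sorry-free; everything is Mathlib. [folklore]
-/

set_option linter.dupNamespace false -- `Summit.<S>.<S>.Theorems…` repeats the summit name (D-0017 layout)

noncomputable section

namespace Summit.HubbardSuperconductivity.HubbardSuperconductivity.Theorems.FSUnfolding

open scoped BigOperators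
open Literature.Probability.LatticeModels Summit.HubbardSuperconductivity.BirComplexStableXYNegative

/-- The phase `φ ↦ i · ↑(∑ w, n w * φ w)` of the Fourier mode `n` is smooth in `φ` (a continuous linear
map followed by the cast `ℝ → ℂ` and multiplication by the constant `i`). [folklore] -/
theorem hsc_contDiff_modePhase {r : ℕ} (n : Freq r) {m : WithTop ℕ∞} :
    ContDiff ℝ m (fun φ : W r → ℝ => Complex.I * ((∑ w, (n w : ℝ) * φ w : ℝ) : ℂ)) := by
  refine contDiff_const.mul ?_
  exact Complex.ofRealCLM.contDiff.comp
    (ContDiff.sum fun w _ => contDiff_const.mul (contDiff_apply ℝ ℝ w))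

/-- The window weight `F(φ) = Σ_n c_n exp(i n·φ)` is `C^m` in `φ` for every `m : WithTop ℕ∞`
(finite sum of constants times complex exponentials of smooth phases). [folklore] -/
theorem hsc_genF_contDiff_withTop {r : ℕ} (c : Table r) {m : WithTop ℕ∞} :
    ContDiff ℝ m (fun φ : W r → ℝ => genF c φ) := by
  classical
  unfold genF Finsupp.sum
  refine ContDiff.sum fun n _ => contDiff_const.mul ?_
  exact Complex.contDiff_exp.comp (hsc_contDiff_modePhase n)

/-- Registered stub `stub_genF_contDiff`: for every window size `r`, table `c : Table r` and natural `N`,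
the window weight `φ ↦ genF c φ` is `C^N` on `W r → ℝ`. [folklore] -/
theorem stub_genF_contDiff :
    ∀ (r : ℕ) (c : Table r) (N : ℕ), ContDiff ℝ N (fun φ : W r → ℝ => genF c φ) :=
  fun _ c _ => hsc_genF_contDiff_withTop c

end Summit.HubbardSuperconductivity.HubbardSuperconductivity.Theorems.FSUnfolding

end
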